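import Summits.CriticalPhenomena.PercolationContinuityZ3.Theorems.SahiMasterFamilyTerminal

/-!
# (EQI-3) in quotable form: the identically-zero locus of `E_3` on product measures is criterion (Z)

Corollaries of `masterFamilyIdentEqIff_three` (`SahiMasterFamilyTerminal.lean`, unit `prim-master-conj`):

* `sahiE_three_ind_identically_zero_iff` — for increasing events `A, B, C` on a finite set,
  `(∀ p ∈ (0,1)^ι, E_3(μ_p; 1_A, 1_B, 1_C) = 0) ↔ ![A, B, C] ∈ Z_3`;
* `sahiE_three_ind_identically_zero_iff_zVia` — the same with `Z_3` unpacked into essential supports (criterion (Z)):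
  for some ordering `(X, Y, G)` of the three events, `esupp X ∩ esupp Y = ∅`, `esupp (X ∩ G) ∩ esupp Y = ∅` and
  `esupp X ∩ esupp (Y ∩ G) = ∅`;
* `sahiE_three_ne_zero_somewhere_of_pairwiseDependent` — three increasing events every two of which share an
  essential coordinate have `E_3(μ_p) ≠ 0` for some interior `p`.
Everything here is proved; axioms standard. [this work]
-/

noncomputable section

open scoped Classical

namespace Summit.CriticalPhenomena.PercolationContinuityZ3.Theorems

open Finset Function
open Literature.Combinatorics.Sahi2008
open Literature.Probability.Percolation (DeterminedBy)
open Literature.Probability.Percolation.DecisionTree (ind)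

/-- **(EQI-3).** For increasing events `A, B, C` on a finite `ι`: `E_3(μ_p; 1_A, 1_B, 1_C) = 0` for every `p` in the
open cube iff `![A, B, C]` lies in the zero-flag class `Z_3`. [this work] -/
theorem sahiE_three_ind_identically_zero_iff {ι : Type} [Fintype ι] {A B C : Set (Set ι)} (hA : IsUpperSet A)
    (hB : IsUpperSet B) (hC : IsUpperSet C) :
    (∀ p : ι → unitInterval, (∀ e, (p e : ℝ) ∈ Set.Ioo (0 : ℝ) 1) →
        sahiE (bernoulliWeight p) 3 ![ind A, ind B, ind C] = 0) ↔ SuppZeroFlag 3 ![A, B, C] := by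
  have hU : ∀ j, IsUpperSet ((![A, B, C] : Fin 3 → Set (Set ι)) j) := by
    intro j; fin_cases j <;> assumption
  have hF : (fun j => ind ((![A, B, C] : Fin 3 → Set (Set ι)) j)) = ![ind A, ind B, ind C] := by
    funext j; fin_cases j <;> rfl
  have key := masterFamilyIdentEqIff_three ι ![A, B, C] hU
  rw [hF] at key
  exact key

/-- **(EQI-3), criterion (Z) spelled out in essential supports.** [this work] -/
theorem sahiE_three_ind_identically_zero_iff_zVia {ι : Type} [Fintype ι] {A B C : Set (Set ι)} (hA : IsUpperSet A)
    (hB : IsUpperSet B) (hC : IsUpperSet C) :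
    (∀ p : ι → unitInterval, (∀ e, (p e : ℝ) ∈ Set.Ioo (0 : ℝ) 1) →
        sahiE (bernoulliWeight p) 3 ![ind A, ind B, ind C] = 0) ↔
      (Disjoint (esupp B) (esupp C) ∧ Disjoint (esupp (B ∩ A)) (esupp C) ∧ Disjoint (esupp B) (esupp (C ∩ A))) ∨
      (Disjoint (esupp A) (esupp C) ∧ Disjoint (esupp (A ∩ B)) (esupp C) ∧ Disjoint (esupp A) (esupp (C ∩ B))) ∨
      (Disjoint (esupp A) (esupp B) ∧ Disjoint (esupp (A ∩ C)) (esupp B) ∧ Disjoint (esupp A) (esupp (B ∩ C))) := by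
  rw [sahiE_three_ind_identically_zero_iff hA hB hC, suppZeroFlag_three_iff_zVia]
  have e : ∀ {X Y G : Set (Set ι)}, IsUpperSet X → IsUpperSet Y → IsUpperSet G →
      (ZVia X Y G ↔ Disjoint (esupp X) (esupp Y) ∧ Disjoint (esupp (X ∩ G)) (esupp Y) ∧
        Disjoint (esupp X) (esupp (Y ∩ G))) := by
    intro X Y G hX hY hG
    simp only [ZVia, suppZeroFlag_two_iff hX hY, suppZeroFlag_two_iff (hX.inter hG) hY,
      suppZeroFlag_two_iff hX (hY.inter hG)]
  rw [e hB hC hA, e hA hC hB, e hA hB hC]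

/-- **(T).** Three increasing events every two of which share an essential coordinate have `E_3(μ_p) ≠ 0` for some
interior `p`. [this work] -/
theorem sahiE_three_ne_zero_somewhere_of_pairwiseDependent {ι : Type} [Fintype ι] {A B C : Set (Set ι)}
    (hA : IsUpperSet A) (hB : IsUpperSet B) (hC : IsUpperSet C) (hAB : (esupp A ∩ esupp B).Nonempty)
    (hAC : (esupp A ∩ esupp C).Nonempty) (hBC : (esupp B ∩ esupp C).Nonempty) :
    ∃ p : ι → unitInterval, (∀ e, (p e : ℝ) ∈ Set.Ioo (0 : ℝ) 1) ∧
      sahiE (bernoulliWeight p) 3 ![ind A, ind B, ind C] ≠ 0 := by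
  by_contra h
  push Not at h
  rcases (sahiE_three_ind_identically_zero_iff_zVia hA hB hC).1 h with ⟨h1, -, -⟩ | ⟨h1, -, -⟩ | ⟨h1, -, -⟩
  · exact Finset.not_disjoint_iff_nonempty_inter.2 hBC h1
  · exact Finset.not_disjoint_iff_nonempty_inter.2 hAC h1
  · exact Finset.not_disjoint_iff_nonempty_inter.2 hAB h1

end Summit.CriticalPhenomena.PercolationContinuityZ3.Theorems
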